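import Summits.QuantumFields.GaugeBoot.Certificates.SparseReducedWindowBound
import Summits.QuantumFields.GaugeBoot.Certificates.KZL2rpD4b1LoRNA
import Summits.QuantumFields.GaugeBoot.Certificates.KZL2rpD4b1LoRNB
import HarnessLib

/-!
# Aggregated equality row `KZL2rpD4b1LoRow` (gb_lean_emit_win 0.10)

HONEST FRAMING (cell `pub-gaugeboot`): certified bounds on lattice expectations at stated coupling,
gauge group, dimension and torus size; NOT a mass gap, NOT a continuum limit, NOT a string tension;
NOT Yang–Mills-summit-bearing (barriers `FixedCouplingUltralocality`, `PerturbativeInvisibility`).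
AGGREGATED-EQUALITY FORM (lead A126 (2)(c)): the 3300 equality rows of `kzL2_D4_b1_max_rp_G2-lower` (sha256 `92e1026dd5df36634aec65f5990dba99000a36f6cfd82974ed6df520c14c07aa`)
enter the certificate `b7f4f94d676cea9d…` only through `Σ_e λ_e · row_e` (λ = the certificate's exact dyadic multipliers).
That row is `a_v = n_v / RD` (numerators `RN`, data parts; common denominator `RD`; 9961 non-zeros of 10878), right-hand side
`rhsN / RD`. INTERFACE (same shape as the kz-L2-H-3D modules `KZL2HD3b…Row`): `RW = [(rhs, [(0, a_0), (1, a_1), …, (10877, a_10877)])]`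
(ALL columns, in order), `rowEQ 0`, `rhsQ 0`, `aggRow`, `aggRhs`, and the cast lemmas `aggRow_cast` / `aggRhs_cast` used by the
certificate module. The certificate theorem is sound for ANY row here (it is a hypothesis); its usefulness rests on the
lattice binding proving `Σ_v aggRow v · y_v = aggRhs` (lean2's aggregated loop-equation row + lean1's binding).
-/

namespace Summit.QuantumFields.GaugeBoot.Certificates.KZL2rpD4b1LoRow

noncomputable section

open Summit.QuantumFields.GaugeBoot.Certificates.Sparse

/-- All numerators `n_v`, `0 ≤ v < 10878` (data parts concatenated). -/
def RN : List ℤ := RNa ++ RNb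

/-- The common denominator `D` of the aggregated row (52 bits). -/
def RD : ℕ := 3799912185593856

/-- Numerator of the right-hand side `Σ_e λ_e rhs_e = rhsN / RD`. -/
def rhsN : ℤ := 0

set_option maxHeartbeats 0 in
/-- `RN` lists exactly 10878 numerators. -/
theorem RN_length : RN.length = 10878 := by
  decide +kernel

/-- `RD > 0`. -/
theorem RD_pos : 0 < RD := by decide

/-- The ONE aggregated row in the shared-row-table shape `[(rhs, [(v, a_v), …])]` (all columns, in order). -/
def RW : List (ℚ × List (ℕ × ℚ)) := [(((rhsN : ℤ) : ℚ) / (RD : ℚ), aggRowQ RN RD)]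

/-- Equality row `e` (only `e = 0`), coefficient of `y_v`. -/
def rowEQ (e : Fin 1) (v : Fin 10878) : ℚ := sget (RW.getD e.val dRow₂).2 v.val

/-- Right-hand side of equality row `e`. -/
def rhsQ (e : Fin 1) : ℚ := (RW.getD e.val dRow₂).1

/-- The aggregated row `a_v = Σ_e λ_e row_e[v] = n_v / RD`. -/
def aggRow (v : Fin 10878) : ℚ := rowEQ 0 v

/-- Its right-hand side `Σ_e λ_e rhs_e = rhsN / RD`. -/
def aggRhs : ℚ := rhsQ 0

/-- `aggRow v = n_v / RD` over `ℝ`. -/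
theorem aggRow_cast (v : Fin 10878) : ((aggRow v : ℚ) : ℝ) = ((RN.getD v.val 0 : ℤ) : ℝ) / (RD : ℝ) :=
  cast_sget_aggRowQ RN RD v.val

/-- `aggRhs = rhsN / RD` over `ℝ`. -/
theorem aggRhs_cast : ((aggRhs : ℚ) : ℝ) = ((rhsN : ℤ) : ℝ) / (RD : ℝ) := by
  show (((((rhsN : ℤ) : ℚ) / (RD : ℚ)) : ℚ) : ℝ) = _
  push_cast; rfl

end

end Summit.QuantumFields.GaugeBoot.Certificates.KZL2rpD4b1LoRow
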